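/-
Copyright: cell gate-hubbard-kl, typer seat t6 (D-0069 (2) B1 statement-typer wave). Proof file: discharges the named
fact `Lemma5RootTestFunctionDecay` of `FermiRG/DR2000PartI.lean`; nothing here is a claim about the Hubbard model or about
superconductivity.
-/
import Mathlib
import Literature.MathematicalPhysics.QuantumLattice.FermiRG.DR2000PartI
import Literature.MathematicalPhysics.QuantumLattice.FermiRG.DR2000AntiperiodisationProof
import Literature.MathematicalPhysics.QuantumLattice.SectorSymbolMasterSmooth
import Literature.Analysis.Fourier.FourierDecayFromDerivBounds
import HarnessLib

/-!
# Disertori–Rivasseau 2000, Part I, Lemma 5 — PROVED: spatial decay of the sectorised root test-function kernel `η_θ`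

M. Disertori, V. Rivasseau, *Interacting Fermi liquid in two dimensions at finite temperature. Part I: Convergent
Attributions*, Commun. Math. Phys. **215** (2000) 251–290, arXiv:cond-mat/9907130 [DisertoriRivasseau2000], §IV.2.1
Lemma 5, render `paper:arxiv-cond-mat_9907130` p0013:L27–61 (LOCATOR = chunk:line of the corpus-TeX render): with
`η̂_{θ}(k) = χ_θ(θ(k⃗)) u(r/Λ_T²)` ((IV.19)), «|η_θ(z)| ≤ K Σ_m Λ_T^{5/2}/[1 + Λ_T²|z₀ + (shift)|² + Λ_T²|z_r|² +
Λ_T|z_t|²]² where z_r and z_t are the radial and tangential components of z⃗ relative to the sector center», shifts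
`m/T` (the typed form, endorsed by the cell referee: the printed «2mβ» is a misprint, see the statement file).  This file
discharges the named fact `Literature.MathematicalPhysics.QuantumLattice.FermiRG.DR2000.Lemma5RootTestFunctionDecay`
(cell FACT-LIST F-045, DAG row DR1.L5) of the DEFINITION-FROZEN statement file `FermiRG/DR2000PartI.lean` WITHOUT
touching that file: `theorem Lemma5RootTestFunctionDecay_holds : Lemma5RootTestFunctionDecay`.

THE ARGUMENT (the printed proof p0013:L38–61, «the spatial decay of η⁰ is obtained by the same sector estimates as for
the tree lines ((IV.21), Appendix A) … applying (II.9)», made explicit).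
1. If `√2πT ≥ Λ` then `Λ_T = √2πT` and every Matsubara frequency `(2n+1)πT` has `k₀² ≥ π²T² = Λ_T²/2`, so the cutoff
   `u(r/Λ_T²)` vanishes at every Matsubara momentum and `η_θ ≡ 0`.
2. If `Λ > √2πT` then `Λ_T = Λ ∈ (0,1]`, `η̂_θ` is `C_c^∞(ℝ × ℝ²)` and Lemma 1 (II.9) (`Lemma1Antiperiodisation_holds`)
   gives `η_θ(z) = Σ_m (−1)^m η⁰_θ(z₀ + m/T, z⃗)` with the `T = 0` kernel `η⁰_θ = (2π)^{−3}∫d³k e^{ikx} η̂_θ`.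
3. The `T = 0` decay `|η⁰_θ(x)| ≤ K Λ^{5/2}/[1 + Λ²x₀² + Λ²x_r² + Λx_t²]²`: the anisotropic sector change of variables
   `k = (Λt₀, (1 + Λt₁) e(θ) + Λ^{1/2} t₂ τ(θ))` (Jacobian `Λ·Λ·Λ^{1/2} = Λ^{5/2}`, `e(θ) = (cos θ, sin θ)` radial,
   `τ(θ) = (−sin θ, cos θ)` tangential) turns `η̂_θ` into a `θ`-INDEPENDENT symbol `M(t; s)`, `s = Λ^{1/2}`, which is a
   smooth function of `(t, s)` DOWN TO `s = 0`: with `U = (1 + s²t₁) + i s t₂` (the point `k⃗` in the frame of the sector),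
   `e(k⃗) = |k⃗|² − 1 = |U|² − 1 = s²·Ẽ`, `Ẽ = 2t₁ + s²t₁² + t₂²` (the curvature of the Fermi circle makes the
   `s t₂`-direction second order), `r/Λ² = t₀² + Ẽ²`, and the relative angle `arg U = s·Ã(t, s)` with `Ã` smooth
   (Hadamard's lemma, `Analysis/Calculus/SlopeQuotient`, applied to the globally smooth truncated argument of
   `Analysis/SpecialFunctions/SmoothTruncatedArg`), so that `χ_θ = u(arg U/s) = u(Ã)`.  Hence all `t`-derivatives of the
   rescaled symbol are bounded UNIFORMLY in `Λ ∈ (0,1]` (continuity on the compact `[0,1] × box`), its support lies in a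
   fixed box, and four integrations by parts (`Analysis/Fourier/FourierDecayFromDerivBounds`) give
   `|𝓕M(y)| ≤ K₁(1 + ‖y‖)^{−4}`; undoing the change of variables (`Analysis/Fourier/FourierLinearChange`) puts the dual
   scales `(Λx₀, Λx_r, Λ^{1/2}x_t)` into `y`.  This is the tree's route for BGM 2006 Lemma 2.2 (modules
   `SectorPropagatorFourier` … `SectorPropagatorDecay`), run for the jellium circle instead of the Hubbard band.
4. Summing the image points `z₀ + m/T` gives the printed majorant.
No definitions; all helpers are `private`.
-/

noncomputable section

open MeasureTheory Set Filter Complex Function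
open scoped Topology BigOperators FourierTransform ContDiff InnerProductSpace

namespace Literature.MathematicalPhysics.QuantumLattice.FermiRG.DR2000

open Literature.MathematicalPhysics.QuantumLattice Literature.Analysis.SpecialFunctions Literature.Analysis.Calculus
  Literature.Analysis.Fourier

/-! ## 1. The cutoff function and the periodised sector cutoff -/

/-- By continuity the cutoff vanishes on the CLOSED set `|r| ≥ 1/2`. [cite: DisertoriRivasseau2000, §II.2 (II.13) p0004:L12–16] -/
private theorem cutoff_eq_zero_of_half_le {u : ℝ → ℝ} (hu : IsCutoff u) {r : ℝ} (hr : 1 / 2 ≤ |r|) : u r = 0 := by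
  rcases hr.lt_or_eq with hr | hr
  · exact hu.eq_zero r hr
  · -- `|r| = 1/2`: approach `r` by the points `r(1 + 1/(n+1))`, where `u` vanishes
    have hr0 : r ≠ 0 := by intro h; rw [h, abs_zero] at hr; norm_num at hr
    have hx : Tendsto (fun n : ℕ => r + r * (1 / ((n : ℝ) + 1))) atTop (𝓝 r) := by
      have h := (tendsto_one_div_add_atTop_nhds_zero_nat.const_mul r).const_add r
      simpa using h
    have hux : Tendsto (fun n : ℕ => u (r + r * (1 / ((n : ℝ) + 1)))) atTop (𝓝 (u r)) :=
      (hu.smooth.continuous.tendsto r).comp hx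
    have hzero : (fun n : ℕ => u (r + r * (1 / ((n : ℝ) + 1)))) = fun _ => 0 := by
      funext n
      apply hu.eq_zero
      have hpos : (0 : ℝ) < 1 / ((n : ℝ) + 1) := by positivity
      have : r + r * (1 / ((n : ℝ) + 1)) = r * (1 + 1 / ((n : ℝ) + 1)) := by ring
      rw [this, abs_mul, abs_of_pos (by positivity : (0 : ℝ) < 1 + 1 / ((n : ℝ) + 1)), ← hr]
      nlinarith
    rw [hzero] at hux
    exact tendsto_nhds_unique hux tendsto_const_nhds

/-- Shift invariance of the periodisation: `u_p(y + nτ) = u_p(y)`. [cite: DisertoriRivasseau2000, §III.3.1 p0009:L66–70] -/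
private theorem periodise_add_int_mul (u : ℝ → ℝ) (τ y : ℝ) (n : ℤ) :
    periodise u τ (y + n * τ) = periodise u τ y := by
  unfold periodise
  have h : (fun m : ℤ => u (y + n * τ - m * τ)) = fun m : ℤ => (fun m' : ℤ => u (y - m' * τ)) (Equiv.subRight n m) := by
    funext m
    simp only [Equiv.subRight_apply, Int.cast_sub]
    ring_nf
  rw [h]
  exact (Equiv.subRight n).tsum_eq fun m' : ℤ => u (y - m' * τ)

/-- For a period `τ > 1`, on `|y| ≤ τ/2` only the central translate survives: `u_p(y) = u(y)`.
[cite: DisertoriRivasseau2000, §III.3.1 p0009:L66–70] -/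
private theorem periodise_eq_of_abs_le {u : ℝ → ℝ} (hu : IsCutoff u) {τ y : ℝ} (hτ : 1 < τ) (hy : |y| ≤ τ / 2) :
    periodise u τ y = u y := by
  unfold periodise
  rw [tsum_eq_single 0]
  · simp
  · intro m hm
    apply hu.eq_zero
    have h1 : (1 : ℝ) ≤ |(m : ℝ)| := by exact_mod_cast Int.one_le_abs hm
    have h2 : τ ≤ |(m : ℝ) * τ| := by
      rw [abs_mul, abs_of_pos (show (0 : ℝ) < τ by linarith)]; nlinarith
    have h3 := abs_sub_abs_le_abs_sub ((m : ℝ) * τ) y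
    rw [abs_sub_comm] at h3
    linarith

/-! ## 2. The master symbol: joint smoothness in the point and the scale -/

/-- The rotated point `U(t; s) = (1 + s²t₁) + i s t₂` is a smooth function on `(ℝ × ℝ) × ℝ³` (second parameter = `s`).
[folklore] -/
private theorem contDiff_U : ContDiff ℝ ∞ fun q : (ℝ × ℝ) × MomSpace =>
    (((1 + q.1.2 ^ 2 * q.2 1 : ℝ) : ℂ) + ((q.1.2 * q.2 2 : ℝ) : ℂ) * I) := by
  have hs : ContDiff ℝ ∞ fun q : (ℝ × ℝ) × MomSpace => q.1.2 := contDiff_snd.comp contDiff_fst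
  have h1 := contDiff_momSpace_coord 1 (n := ∞)
  have h2 := contDiff_momSpace_coord 2 (n := ∞)
  have ha : ContDiff ℝ ∞ fun q : (ℝ × ℝ) × MomSpace => ((1 + q.1.2 ^ 2 * q.2 1 : ℝ) : ℂ) :=
    ofRealCLM.contDiff.comp (contDiff_const.add ((hs.pow 2).mul h1))
  have hb : ContDiff ℝ ∞ fun q : (ℝ × ℝ) × MomSpace => ((q.1.2 * q.2 2 : ℝ) : ℂ) :=
    ofRealCLM.contDiff.comp (hs.mul h2)
  exact ha.add (hb.mul contDiff_const)

/-- The truncated relative angle `(t, s) ↦ truncArg(U(t; s))` is smooth on `ℝ³ × ℝ`. [folklore] -/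
private theorem contDiff_angFun : ContDiff ℝ ∞ fun p : MomSpace × ℝ =>
    truncArg (1 / 4) (Real.cos (7 * Real.pi / 8)) (Real.cos (15 * Real.pi / 16))
      (((1 + p.2 ^ 2 * p.1 1 : ℝ) : ℂ) + ((p.2 * p.1 2 : ℝ) : ℂ) * I) := by
  have hU : ContDiff ℝ ∞ fun p : MomSpace × ℝ => (((1 + p.2 ^ 2 * p.1 1 : ℝ) : ℂ) + ((p.2 * p.1 2 : ℝ) : ℂ) * I) := by
    have h := contDiff_U.comp ((contDiff_const.prodMk contDiff_snd).prodMk contDiff_fst :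
      ContDiff ℝ ∞ fun p : MomSpace × ℝ => ((((0 : ℝ), p.2), p.1) : (ℝ × ℝ) × MomSpace))
    exact h
  exact (contDiff_truncArg (by norm_num) cos_fifteen_lt_cos_seven neg_one_lt_cos_fifteen).comp hU

/-- **The master symbol is jointly smooth** in `((·, s), t) ∈ ℝ² × ℝ³` (the first parameter is a dummy):
`M(t; s) = u(t₀² + Ẽ²) ψ(U) u(Ã)`. [cite: DisertoriRivasseau2000, §IV.2.1 Lemma 5 p0013:L38–61] -/
private theorem contDiff_master {u : ℝ → ℝ} (hu : IsCutoff u) : ContDiff ℝ ∞ fun q : (ℝ × ℝ) × MomSpace =>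
    ((u (q.2 0 ^ 2 + (2 * q.2 1 + q.1.2 ^ 2 * q.2 1 ^ 2 + q.2 2 ^ 2) ^ 2) *
        truncOne (1 / 2) (Real.cos (3 * Real.pi / 4)) (Real.cos (7 * Real.pi / 8))
          (((1 + q.1.2 ^ 2 * q.2 1 : ℝ) : ℂ) + ((q.1.2 * q.2 2 : ℝ) : ℂ) * I) *
        u (slopeQuot (fun p : MomSpace × ℝ =>
            truncArg (1 / 4) (Real.cos (7 * Real.pi / 8)) (Real.cos (15 * Real.pi / 16))
              (((1 + p.2 ^ 2 * p.1 1 : ℝ) : ℂ) + ((p.2 * p.1 2 : ℝ) : ℂ) * I)) (q.2, q.1.2)) : ℝ) : ℂ) := by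
  have hs : ContDiff ℝ ∞ fun q : (ℝ × ℝ) × MomSpace => q.1.2 := contDiff_snd.comp contDiff_fst
  have h0 := contDiff_momSpace_coord 0 (n := ∞)
  have h1 := contDiff_momSpace_coord 1 (n := ∞)
  have h2 := contDiff_momSpace_coord 2 (n := ∞)
  refine ofRealCLM.contDiff.comp ((?_ : ContDiff ℝ ∞ _).mul ?_ |>.mul ?_)
  · -- the cutoff factor `u(t₀² + Ẽ²)`
    exact hu.smooth.comp ((h0.pow 2).add ((((contDiff_const.mul h1).add ((hs.pow 2).mul (h1.pow 2))).add (h2.pow 2)).pow 2))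
  · -- the truncation `ψ(U)`
    exact (contDiff_truncOne (by norm_num)).comp contDiff_U
  · -- the rescaled angle `u(Ã)`
    have hQ := contDiff_slopeQuot_infty contDiff_angFun
    exact hu.smooth.comp (hQ.comp (contDiff_snd.prodMk hs))

/-! ## 3. The rescaled symbol is the master symbol -/

/-- The chart point `(1 + s²t₁) e(θ) + s t₂ τ(θ)` as a complex number is `e^{iθ} · U`, `U = (1 + s²t₁) + i s t₂`. [folklore] -/
private theorem momToComplex_chart (s θ : ℝ) (t : MomSpace) :
    momToComplex ![Real.cos θ + s ^ 2 * t 1 * Real.cos θ - s * t 2 * Real.sin θ,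
        Real.sin θ + s ^ 2 * t 1 * Real.sin θ + s * t 2 * Real.cos θ] =
      ((Real.cos θ : ℂ) + (Real.sin θ : ℂ) * I) * (((1 + s ^ 2 * t 1 : ℝ) : ℂ) + ((s * t 2 : ℝ) : ℂ) * I) := by
  apply Complex.ext
  · simp only [momToComplex_re, Matrix.cons_val_zero, mul_re, add_re, ofReal_re, mul_im, ofReal_im, I_re, I_im,
      add_im, mul_zero, sub_zero, add_zero, mul_one, zero_add]
    ring
  · simp only [momToComplex_im, Matrix.cons_val_one, Matrix.cons_val_zero, mul_re, add_re, ofReal_re,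
      mul_im, ofReal_im, I_re, I_im, add_im, mul_zero, sub_zero, add_zero, mul_one, zero_add]
    ring

/-- The unit vector `e^{iθ} = cos θ + i sin θ` is nonzero. [folklore] -/
private theorem cos_add_sin_mul_I_ne_zero (θ : ℝ) : ((Real.cos θ : ℂ) + (Real.sin θ : ℂ) * I) ≠ 0 := by
  intro h
  have h1 := congrArg Complex.re h
  have h2 := congrArg Complex.im h
  simp only [add_re, ofReal_re, mul_re, I_re, mul_zero, ofReal_im, I_im, mul_one, sub_self, add_zero, zero_re,
    add_im, mul_im, zero_add, zero_im] at h1 h2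
  nlinarith [Real.sin_sq_add_cos_sq θ]

/-- The polar angle of the chart point is `θ + arg U` modulo `2π` (`U ≠ 0`). [folklore] -/
private theorem polarAngle_chart {s θ : ℝ} {t : MomSpace}
    (hU : (((1 + s ^ 2 * t 1 : ℝ) : ℂ) + ((s * t 2 : ℝ) : ℂ) * I) ≠ 0) :
    ∃ n : ℤ, polarAngle ![Real.cos θ + s ^ 2 * t 1 * Real.cos θ - s * t 2 * Real.sin θ,
        Real.sin θ + s ^ 2 * t 1 * Real.sin θ + s * t 2 * Real.cos θ] - θ =
      arg (((1 + s ^ 2 * t 1 : ℝ) : ℂ) + ((s * t 2 : ℝ) : ℂ) * I) + 2 * Real.pi * n := by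
  have hangle : ((polarAngle ![Real.cos θ + s ^ 2 * t 1 * Real.cos θ - s * t 2 * Real.sin θ,
        Real.sin θ + s ^ 2 * t 1 * Real.sin θ + s * t 2 * Real.cos θ] : ℝ) : Real.Angle) =
      ((θ + arg (((1 + s ^ 2 * t 1 : ℝ) : ℂ) + ((s * t 2 : ℝ) : ℂ) * I) : ℝ) : Real.Angle) := by
    rw [polarAngle, momToComplex_chart, arg_mul_coe_angle (cos_add_sin_mul_I_ne_zero θ) hU, Real.Angle.coe_add]
    congr 1
    have h := arg_cos_add_sin_mul_I_coe_angle (θ : Real.Angle)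
    rw [Real.Angle.cos_coe, Real.Angle.sin_coe] at h
    exact h
  obtain ⟨n, hn⟩ := Real.Angle.angle_eq_iff_two_pi_dvd_sub.1 hangle
  exact ⟨n, by linarith⟩

/-- In the chart, `r/Λ² = t₀² + Ẽ²` with `Ẽ = 2t₁ + s²t₁² + t₂²` (`|k⃗|² − 1 = s²Ẽ`, `k₀ = s²t₀`, `Λ = s²`).
[cite: DisertoriRivasseau2000, §II.2 (II.12) p0004:L10–11] -/
private theorem rOf_chart {s : ℝ} (hs : s ≠ 0) (θ : ℝ) (t : MomSpace) :
    rOf (s ^ 2 * t 0, ![Real.cos θ + s ^ 2 * t 1 * Real.cos θ - s * t 2 * Real.sin θ,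
        Real.sin θ + s ^ 2 * t 1 * Real.sin θ + s * t 2 * Real.cos θ]) / (s ^ 2) ^ 2 =
      t 0 ^ 2 + (2 * t 1 + s ^ 2 * t 1 ^ 2 + t 2 ^ 2) ^ 2 := by
  have hd : dispersion ![Real.cos θ + s ^ 2 * t 1 * Real.cos θ - s * t 2 * Real.sin θ,
      Real.sin θ + s ^ 2 * t 1 * Real.sin θ + s * t 2 * Real.cos θ] = s ^ 2 * (2 * t 1 + s ^ 2 * t 1 ^ 2 + t 2 ^ 2) := by
    rw [dispersion]
    simp only [Matrix.cons_val_zero, Matrix.cons_val_one]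
    linear_combination ((1 + s ^ 2 * t 1) ^ 2 + (s * t 2) ^ 2) * Real.sin_sq_add_cos_sq θ
  rw [rOf]
  simp only
  rw [hd, div_eq_iff (by positivity)]
  ring

/-- `‖U‖² = 1 + s²Ẽ`. [folklore] -/
private theorem norm_U_sq (s : ℝ) (t : MomSpace) :
    ‖(((1 + s ^ 2 * t 1 : ℝ) : ℂ) + ((s * t 2 : ℝ) : ℂ) * I)‖ ^ 2 = 1 + s ^ 2 * (2 * t 1 + s ^ 2 * t 1 ^ 2 + t 2 ^ 2) := by
  rw [Complex.sq_norm, Complex.normSq_apply]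
  simp only [add_re, ofReal_re, mul_re, I_re, mul_zero, ofReal_im, I_im, mul_one, sub_self, add_zero, add_im,
    mul_im, zero_add]
  ring

/-- **The sector cutoff in the chart**: for `0 < s ≤ 1` and `U ≠ 0`, `χ_θ(θ(k⃗)) = u(arg U / s)` — the `2π`-periodised
cutoff of period `2πα^{1/4} = 2π/s` evaluated at `α^{1/4}(θ(k⃗) − θ) = (arg U + 2πn)/s` keeps exactly its central translate.
[cite: DisertoriRivasseau2000, §III.3.1 (III.10)–(III.11) p0009:L57–78] -/
private theorem sectorChiMom_chart {u : ℝ → ℝ} (hu : IsCutoff u) {s : ℝ} (hs : 0 < s) (hs1 : s ≤ 1) (θ : ℝ)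
    (t : MomSpace) (hU0 : (((1 + s ^ 2 * t 1 : ℝ) : ℂ) + ((s * t 2 : ℝ) : ℂ) * I) ≠ 0) :
    sectorChiMom u (1 / (s ^ 2) ^ 2) θ
        ![Real.cos θ + s ^ 2 * t 1 * Real.cos θ - s * t 2 * Real.sin θ,
          Real.sin θ + s ^ 2 * t 1 * Real.sin θ + s * t 2 * Real.cos θ] =
      u (arg (((1 + s ^ 2 * t 1 : ℝ) : ℂ) + ((s * t 2 : ℝ) : ℂ) * I) / s) := by
  set U : ℂ := ((1 + s ^ 2 * t 1 : ℝ) : ℂ) + ((s * t 2 : ℝ) : ℂ) * I with hUdef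
  have hπ := Real.pi_gt_three
  obtain ⟨n, hn⟩ := polarAngle_chart (s := s) (θ := θ) (t := t) hU0
  have hw : (1 / (s ^ 2) ^ 2 : ℝ) ^ (1 / 4 : ℝ) = s⁻¹ := by
    rw [show (1 / (s ^ 2) ^ 2 : ℝ) = s⁻¹ ^ 4 by rw [one_div, inv_pow, ← pow_mul],
      show (1 / 4 : ℝ) = ((4 : ℕ) : ℝ)⁻¹ by norm_num]
    exact Real.pow_rpow_inv_natCast (inv_pos.2 hs).le (by norm_num)
  have hsinv : 1 ≤ s⁻¹ := (one_le_inv₀ hs).2 hs1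
  rw [sectorChiMom, sectorChi, hw, hn, show s⁻¹ * (arg U + 2 * Real.pi * n) = s⁻¹ * arg U + n * (2 * Real.pi * s⁻¹) by ring,
    periodise_add_int_mul, periodise_eq_of_abs_le hu, inv_mul_eq_div]
  · calc (1 : ℝ) < 2 * Real.pi := by linarith
      _ ≤ 2 * Real.pi * s⁻¹ := le_mul_of_one_le_right (by positivity) hsinv
  · rw [abs_mul, abs_of_pos (inv_pos.2 hs), show 2 * Real.pi * s⁻¹ / 2 = s⁻¹ * Real.pi by ring]
    exact mul_le_mul_of_nonneg_left (Complex.abs_arg_le_pi U) (inv_pos.2 hs).le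

/-- **The rescaled symbol is the master symbol**: for `0 < s ≤ 1` (`Λ = s²`), every sector centre `θ` and every
rescaled point `t`, the root symbol `χ_θ(θ(k⃗)) u(r/Λ²)` at the chart point `k = (Λt₀, (1 + Λt₁)e(θ) + s t₂ τ(θ))`
equals `u(t₀² + Ẽ²) ψ(U) u(Ã(t; s))` — independent of `θ` (rotation invariance of the jellium Fermi circle).
[cite: DisertoriRivasseau2000, §IV.2.1 (IV.19) p0013:L27–29, §III.3.1 (III.10)–(III.11) p0009:L57–71] -/
private theorem rescaled_eq_master {u : ℝ → ℝ} (hu : IsCutoff u) {s : ℝ} (hs : 0 < s) (hs1 : s ≤ 1) (θ : ℝ)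
    (t : MomSpace) :
    sectorChiMom u (1 / (s ^ 2) ^ 2) θ
          ![Real.cos θ + s ^ 2 * t 1 * Real.cos θ - s * t 2 * Real.sin θ,
            Real.sin θ + s ^ 2 * t 1 * Real.sin θ + s * t 2 * Real.cos θ] *
        u (rOf (s ^ 2 * t 0, ![Real.cos θ + s ^ 2 * t 1 * Real.cos θ - s * t 2 * Real.sin θ,
            Real.sin θ + s ^ 2 * t 1 * Real.sin θ + s * t 2 * Real.cos θ]) / (s ^ 2) ^ 2) =
      u (t 0 ^ 2 + (2 * t 1 + s ^ 2 * t 1 ^ 2 + t 2 ^ 2) ^ 2) *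
        truncOne (1 / 2) (Real.cos (3 * Real.pi / 4)) (Real.cos (7 * Real.pi / 8))
          (((1 + s ^ 2 * t 1 : ℝ) : ℂ) + ((s * t 2 : ℝ) : ℂ) * I) *
        u (slopeQuot (fun p : MomSpace × ℝ =>
            truncArg (1 / 4) (Real.cos (7 * Real.pi / 8)) (Real.cos (15 * Real.pi / 16))
              (((1 + p.2 ^ 2 * p.1 1 : ℝ) : ℂ) + ((p.2 * p.1 2 : ℝ) : ℂ) * I)) (t, s)) := by
  -- notation
  set U : ℂ := ((1 + s ^ 2 * t 1 : ℝ) : ℂ) + ((s * t 2 : ℝ) : ℂ) * I with hUdef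
  set E : ℝ := 2 * t 1 + s ^ 2 * t 1 ^ 2 + t 2 ^ 2 with hE
  have hs0 : s ≠ 0 := hs.ne'
  have hπ := Real.pi_gt_three
  rw [rOf_chart hs0 θ t]
  by_cases hu0 : u (t 0 ^ 2 + E ^ 2) = 0
  · rw [hu0]; ring
  -- on the support of the cutoff: `Ẽ > -3/4`, `‖U‖ ≥ 1/2`
  have hsupp : t 0 ^ 2 + E ^ 2 ≤ 1 / 2 := by
    by_contra h
    exact hu0 (hu.eq_zero _ (by rw [abs_of_nonneg (by positivity)]; linarith))
  have hnormsq : ‖U‖ ^ 2 = 1 + s ^ 2 * E := norm_U_sq s t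
  have hE34 : -(3 / 4) < E := by nlinarith [sq_nonneg (t 0)]
  have hs2 : s ^ 2 ≤ 1 := by nlinarith
  have hnorm : 1 / 2 ≤ ‖U‖ := by
    have h1 : 1 / 4 ≤ ‖U‖ ^ 2 := by
      rw [hnormsq]; nlinarith [mul_nonneg (sq_nonneg s) (by linarith : (0 : ℝ) ≤ E + 3 / 4)]
    nlinarith [norm_nonneg U]
  have hU0 : U ≠ 0 := by intro h; rw [h, norm_zero] at hnorm; linarith
  -- the angular factor: `χ_θ(θ(k⃗)) = u(arg U / s)`
  rw [sectorChiMom_chart hu hs hs1 θ t hU0]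
  -- the rescaled angle: `angFun(t, s) = s · Ã(t, s)` with `angFun(t, 0) = 0`
  set Q : ℝ := slopeQuot (fun p : MomSpace × ℝ =>
      truncArg (1 / 4) (Real.cos (7 * Real.pi / 8)) (Real.cos (15 * Real.pi / 16))
        (((1 + p.2 ^ 2 * p.1 1 : ℝ) : ℂ) + ((p.2 * p.1 2 : ℝ) : ℂ) * I)) (t, s) with hQ
  have hsmul : truncArg (1 / 4) (Real.cos (7 * Real.pi / 8)) (Real.cos (15 * Real.pi / 16)) U = s * Q := by
    have h := eq_add_smul_slopeQuot contDiff_angFun (by simp) t s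
    have h0 : truncArg (1 / 4) (Real.cos (7 * Real.pi / 8)) (Real.cos (15 * Real.pi / 16))
        (((1 + (0 : ℝ) ^ 2 * t 1 : ℝ) : ℂ) + (((0 : ℝ) * t 2 : ℝ) : ℂ) * I) = 0 := by
      have h1 : (((1 + (0 : ℝ) ^ 2 * t 1 : ℝ) : ℂ) + (((0 : ℝ) * t 2 : ℝ) : ℂ) * I) = 1 := by push_cast; ring
      rw [h1, truncArg, arg_one, mul_zero]
    simp only [h0, zero_add, smul_eq_mul] at h
    rw [hUdef]
    exact h
  have habs_div : |arg U / s| = |arg U| / s := by rw [abs_div, abs_of_pos hs]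
  have habs_ge : |arg U| ≤ |arg U| / s := by
    rw [le_div_iff₀ hs]; exact mul_le_of_le_one_right (abs_nonneg _) hs1
  by_cases h78 : |arg U| ≤ 7 * Real.pi / 8
  · -- `truncArg U = arg U`, hence `Ã = arg U / s`
    have htr : truncArg (1 / 4) (Real.cos (7 * Real.pi / 8)) (Real.cos (15 * Real.pi / 16)) U = arg U :=
      truncArg_eq_arg_of_abs_arg_le (by norm_num) cos_fifteen_lt_cos_seven (by linarith) le_rfl (by linarith) h78
    have hQeq : Q = arg U / s := by
      rw [eq_div_iff hs0, mul_comm, ← hsmul, htr]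
    rw [hQeq]
    by_cases h34 : |arg U| ≤ 3 * Real.pi / 4
    · -- the generic point: `ψ(U) = 1`
      have hone : truncOne (1 / 2) (Real.cos (3 * Real.pi / 4)) (Real.cos (7 * Real.pi / 8)) U = 1 :=
        truncOne_eq_one_of_abs_arg_le (by norm_num) cos_seven_lt_cos_three (by linarith) le_rfl hnorm h34
      rw [hone]; ring
    · -- `3π/4 < |arg U| ≤ 7π/8`: the sector cutoff vanishes on both sides
      push Not at h34
      have hzero : u (arg U / s) = 0 := hu.eq_zero _ (by rw [habs_div]; linarith)
      rw [hzero]; ring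
  · -- `|arg U| > 7π/8`: `ψ(U) = 0` and the sector cutoff vanishes
    push Not at h78
    have hψ : truncOne (1 / 2) (Real.cos (3 * Real.pi / 4)) (Real.cos (7 * Real.pi / 8)) U = 0 :=
      truncOne_eq_zero_of_le_abs_arg cos_seven_lt_cos_three (by positivity) le_rfl hU0 h78.le
    have hzero : u (arg U / s) = 0 := hu.eq_zero _ (by rw [habs_div]; linarith)
    rw [hψ, hzero]; ring

/-! ## 4. The support box and the scale-uniform derivative bounds of the rescaled symbol -/

/-- **The support box**: if the rescaled root symbol does not vanish at `t` then `|t₀| ≤ 1`, `|t₁| ≤ 2`, `|t₂| ≤ 1`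
(`t₀² + Ẽ² ≤ 1/2`, and the sector condition `|arg U| ≤ s/2` pins `Re U = 1 + s²t₁` to `1 + O(s²)` and `Im U = s t₂` to
`O(s)` — the `Λ × Λ^{1/2}` box of the sector). [cite: DisertoriRivasseau2000, §IV.1 (IV.12)–(IV.13) p0012:L186–208] -/
private theorem box_of_ne_zero {u : ℝ → ℝ} (hu : IsCutoff u) {s : ℝ} (hs : 0 < s) (hs1 : s ≤ 1) (θ : ℝ)
    (t : MomSpace)
    (h : sectorChiMom u (1 / (s ^ 2) ^ 2) θ
          ![Real.cos θ + s ^ 2 * t 1 * Real.cos θ - s * t 2 * Real.sin θ,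
            Real.sin θ + s ^ 2 * t 1 * Real.sin θ + s * t 2 * Real.cos θ] *
        u (rOf (s ^ 2 * t 0, ![Real.cos θ + s ^ 2 * t 1 * Real.cos θ - s * t 2 * Real.sin θ,
            Real.sin θ + s ^ 2 * t 1 * Real.sin θ + s * t 2 * Real.cos θ]) / (s ^ 2) ^ 2) ≠ 0) :
    |t 0| ≤ 1 ∧ |t 1| ≤ 2 ∧ |t 2| ≤ 1 := by
  set U : ℂ := ((1 + s ^ 2 * t 1 : ℝ) : ℂ) + ((s * t 2 : ℝ) : ℂ) * I with hUdef
  set E : ℝ := 2 * t 1 + s ^ 2 * t 1 ^ 2 + t 2 ^ 2 with hE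
  have hs0 : s ≠ 0 := hs.ne'
  rw [rOf_chart hs0 θ t] at h
  obtain ⟨hχ, hu0⟩ := mul_ne_zero_iff.1 h
  -- the radial cutoff: `t₀² + Ẽ² ≤ 1/2`, hence `|Ẽ| < 3/4`
  have hsupp : t 0 ^ 2 + E ^ 2 ≤ 1 / 2 := by
    by_contra h'
    exact hu0 (hu.eq_zero _ (by rw [abs_of_nonneg (by positivity)]; linarith))
  have hE2 : E ^ 2 < (3 / 4) ^ 2 := by linarith [sq_nonneg (t 0)]
  obtain ⟨hE34, hE34'⟩ := abs_lt_of_sq_lt_sq' hE2 (by norm_num)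
  have hs2 : s ^ 2 ≤ 1 := by nlinarith
  have hss : 0 < s ^ 2 := by positivity
  have hnormsq : ‖U‖ ^ 2 = 1 + s ^ 2 * E := norm_U_sq s t
  have hsE_lo : s ^ 2 * (-(3 / 4)) ≤ s ^ 2 * E := mul_le_mul_of_nonneg_left hE34.le hss.le
  have hsE_hi : s ^ 2 * E ≤ s ^ 2 * (3 / 4) := mul_le_mul_of_nonneg_left hE34'.le hss.le
  have hnorm_lo : 1 - 3 / 4 * s ^ 2 ≤ ‖U‖ ^ 2 := by rw [hnormsq]; linarith
  have hnorm_hi : ‖U‖ ^ 2 ≤ 1 + 3 / 4 * s ^ 2 := by rw [hnormsq]; linarith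
  have hU0 : U ≠ 0 := by
    intro h0; rw [h0, norm_zero] at hnorm_lo; linarith
  have hUpos : 0 < ‖U‖ := norm_pos_iff.2 hU0
  have hnorm2 : ‖U‖ ≤ 2 := (pow_le_pow_iff_left₀ hUpos.le zero_le_two two_ne_zero).1 (by linarith)
  -- the sector cutoff: `|arg U| ≤ s/2`
  rw [sectorChiMom_chart hu hs hs1 θ t hU0] at hχ
  have harg : |arg U| ≤ s / 2 := by
    by_contra h'
    refine hχ (hu.eq_zero _ ?_)
    rw [abs_div, abs_of_pos hs, lt_div_iff₀ hs]
    linarith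
  -- `Im U = ‖U‖ sin(arg U)`, `Re U = ‖U‖ cos(arg U)`
  have him : s * t 2 = ‖U‖ * Real.sin (arg U) := by
    rw [Complex.sin_arg, mul_div_cancel₀ _ hUpos.ne']
    simp only [hUdef, add_im, ofReal_im, mul_im, ofReal_re, I_re, I_im, mul_zero, mul_one, zero_add, add_zero]
  have hre : 1 + s ^ 2 * t 1 = ‖U‖ * Real.cos (arg U) := by
    rw [Complex.cos_arg hU0, mul_div_cancel₀ _ hUpos.ne']
    simp only [hUdef, add_re, ofReal_re, mul_re, ofReal_im, I_re, I_im, mul_zero, mul_one, add_zero, sub_self]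
  have hsin : |Real.sin (arg U)| ≤ s / 2 := Real.abs_sin_le_abs.trans harg
  have hcos : 1 - s ^ 2 / 8 ≤ Real.cos (arg U) := by
    have h1 := Real.one_sub_sq_div_two_le_cos (x := arg U)
    have h2 : (arg U) ^ 2 ≤ (s / 2) ^ 2 := by
      rw [← sq_abs]; exact pow_le_pow_left₀ (abs_nonneg _) harg 2
    linarith
  refine ⟨?_, ?_, ?_⟩
  · -- `t₀² ≤ 1/2`
    exact (sq_le_one_iff_abs_le_one _).1 (by linarith [sq_nonneg E])
  · -- `Re U = 1 + s²t₁ ∈ [1 − 2s², 1 + 2s²]`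
    have hup : ‖U‖ ≤ 1 + 2 * s ^ 2 := by
      refine (pow_le_pow_iff_left₀ hUpos.le (by positivity) two_ne_zero).1 (hnorm_hi.trans ?_)
      have : (1 + 2 * s ^ 2) ^ 2 = 1 + 3 / 4 * s ^ 2 + (13 / 4 * s ^ 2 + 4 * (s ^ 2) ^ 2) := by ring
      rw [this]
      linarith [sq_nonneg (s ^ 2)]
    have hlo : 1 - s ^ 2 ≤ ‖U‖ := by
      by_cases h1 : 1 ≤ ‖U‖
      · linarith
      · push Not at h1
        have : ‖U‖ ^ 2 ≤ ‖U‖ := by rw [sq]; exact mul_le_of_le_one_right hUpos.le h1.le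
        linarith
    have ht1up : s ^ 2 * t 1 ≤ s ^ 2 * 2 := by
      have : ‖U‖ * Real.cos (arg U) ≤ ‖U‖ := mul_le_of_le_one_right hUpos.le (Real.cos_le_one _)
      linarith
    have ht1lo : s ^ 2 * (-2) ≤ s ^ 2 * t 1 := by
      have h1 : (1 - s ^ 2) * (1 - s ^ 2 / 8) ≤ ‖U‖ * Real.cos (arg U) :=
        mul_le_mul hlo hcos (by linarith) hUpos.le
      have h2 : (1 - s ^ 2) * (1 - s ^ 2 / 8) = 1 + s ^ 2 * (-2) + (7 / 8 * s ^ 2 + (s ^ 2) ^ 2 / 8) := by ring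
      rw [h2] at h1
      linarith [sq_nonneg (s ^ 2)]
    exact abs_le.2 ⟨le_of_mul_le_mul_left ht1lo hss, le_of_mul_le_mul_left ht1up hss⟩
  · -- `|Im U| = s|t₂| ≤ ‖U‖ s/2 ≤ s`
    have h1 : |s * t 2| ≤ 2 * (s / 2) := by
      rw [him, abs_mul, abs_of_pos hUpos]
      exact mul_le_mul hnorm2 hsin (abs_nonneg _) (by norm_num)
    rw [abs_mul, abs_of_pos hs] at h1
    exact le_of_mul_le_mul_left (by linarith) hs

/-- The rescaled root symbol (as a complex function of the rescaled point) is the slice `t ↦ M(t; s)` of the jointly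
smooth master lift. [cite: DisertoriRivasseau2000, §IV.2.1 Lemma 5 p0013:L38–61] -/
private theorem rescaled_eq_slice {u : ℝ → ℝ} (hu : IsCutoff u) {s : ℝ} (hs : 0 < s) (hs1 : s ≤ 1) (θ : ℝ) :
    (fun t : MomSpace => ((sectorChiMom u (1 / (s ^ 2) ^ 2) θ
          ![Real.cos θ + s ^ 2 * t 1 * Real.cos θ - s * t 2 * Real.sin θ,
            Real.sin θ + s ^ 2 * t 1 * Real.sin θ + s * t 2 * Real.cos θ] *
        u (rOf (s ^ 2 * t 0, ![Real.cos θ + s ^ 2 * t 1 * Real.cos θ - s * t 2 * Real.sin θ,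
            Real.sin θ + s ^ 2 * t 1 * Real.sin θ + s * t 2 * Real.cos θ]) / (s ^ 2) ^ 2) : ℝ) : ℂ)) =
      fun t : MomSpace => (fun q : (ℝ × ℝ) × MomSpace =>
        ((u (q.2 0 ^ 2 + (2 * q.2 1 + q.1.2 ^ 2 * q.2 1 ^ 2 + q.2 2 ^ 2) ^ 2) *
            truncOne (1 / 2) (Real.cos (3 * Real.pi / 4)) (Real.cos (7 * Real.pi / 8))
              (((1 + q.1.2 ^ 2 * q.2 1 : ℝ) : ℂ) + ((q.1.2 * q.2 2 : ℝ) : ℂ) * I) *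
            u (slopeQuot (fun p : MomSpace × ℝ =>
                truncArg (1 / 4) (Real.cos (7 * Real.pi / 8)) (Real.cos (15 * Real.pi / 16))
                  (((1 + p.2 ^ 2 * p.1 1 : ℝ) : ℂ) + ((p.2 * p.1 2 : ℝ) : ℂ) * I)) (q.2, q.1.2)) : ℝ) : ℂ))
        (((0 : ℝ), s), t) := by
  funext t
  rw [rescaled_eq_master hu hs hs1 θ t]

/-- The rescaled root symbol is smooth. [folklore] -/
private theorem contDiff_rescaled {u : ℝ → ℝ} (hu : IsCutoff u) {s : ℝ} (hs : 0 < s) (hs1 : s ≤ 1) (θ : ℝ) :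
    ContDiff ℝ ∞ fun t : MomSpace => ((sectorChiMom u (1 / (s ^ 2) ^ 2) θ
          ![Real.cos θ + s ^ 2 * t 1 * Real.cos θ - s * t 2 * Real.sin θ,
            Real.sin θ + s ^ 2 * t 1 * Real.sin θ + s * t 2 * Real.cos θ] *
        u (rOf (s ^ 2 * t 0, ![Real.cos θ + s ^ 2 * t 1 * Real.cos θ - s * t 2 * Real.sin θ,
            Real.sin θ + s ^ 2 * t 1 * Real.sin θ + s * t 2 * Real.cos θ]) / (s ^ 2) ^ 2) : ℝ) : ℂ) := by
  rw [rescaled_eq_slice hu hs hs1 θ]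
  exact (contDiff_master hu).comp (contDiff_const.prodMk contDiff_id)

/-- The rescaled root symbol is supported in the box `{|t₀| ≤ 1, |t₁| ≤ 2, |t₂| ≤ 1}`. [folklore] -/
private theorem tsupport_rescaled_subset {u : ℝ → ℝ} (hu : IsCutoff u) {s : ℝ} (hs : 0 < s) (hs1 : s ≤ 1) (θ : ℝ) :
    tsupport (fun t : MomSpace => ((sectorChiMom u (1 / (s ^ 2) ^ 2) θ
          ![Real.cos θ + s ^ 2 * t 1 * Real.cos θ - s * t 2 * Real.sin θ,
            Real.sin θ + s ^ 2 * t 1 * Real.sin θ + s * t 2 * Real.cos θ] *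
        u (rOf (s ^ 2 * t 0, ![Real.cos θ + s ^ 2 * t 1 * Real.cos θ - s * t 2 * Real.sin θ,
            Real.sin θ + s ^ 2 * t 1 * Real.sin θ + s * t 2 * Real.cos θ]) / (s ^ 2) ^ 2) : ℝ) : ℂ)) ⊆
      {t : MomSpace | |t 0| ≤ 1 ∧ |t 1| ≤ 2 ∧ |t 2| ≤ 1} :=
  closure_minimal (fun v hv => box_of_ne_zero hu hs hs1 θ v fun h0 =>
    Function.mem_support.1 hv (by rw [h0, Complex.ofReal_zero])) (isCompact_momBox _ _ _).isClosed

/-- **Scale-uniform derivative bounds of the rescaled root symbol**: for every order `m` there is `B` with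
`‖D^m R_{s,θ}(t)‖ ≤ B` for all `0 < s ≤ 1`, all sector centres `θ` and all `t` (continuity of `D^m` of the master lift on
the compact `[0,1] × box`). [cite: DisertoriRivasseau2000, §IV.2.1 Lemma 5 p0013:L38–61] -/
private theorem exists_iteratedFDeriv_rescaled_le {u : ℝ → ℝ} (hu : IsCutoff u) (m : ℕ) :
    ∃ B : ℝ, 0 ≤ B ∧ ∀ (s θ : ℝ), 0 < s → s ≤ 1 → ∀ t : MomSpace,
      ‖iteratedFDeriv ℝ m (fun t : MomSpace => ((sectorChiMom u (1 / (s ^ 2) ^ 2) θ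
          ![Real.cos θ + s ^ 2 * t 1 * Real.cos θ - s * t 2 * Real.sin θ,
            Real.sin θ + s ^ 2 * t 1 * Real.sin θ + s * t 2 * Real.cos θ] *
        u (rOf (s ^ 2 * t 0, ![Real.cos θ + s ^ 2 * t 1 * Real.cos θ - s * t 2 * Real.sin θ,
            Real.sin θ + s ^ 2 * t 1 * Real.sin θ + s * t 2 * Real.cos θ]) / (s ^ 2) ^ 2) : ℝ) : ℂ)) t‖ ≤ B := by
  have hF := contDiff_master hu
  set P : Set (ℝ × ℝ) := Icc 0 0 ×ˢ Icc 0 1 with hP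
  set T : Set MomSpace := {t | |t 0| ≤ 1 ∧ |t 1| ≤ 2 ∧ |t 2| ≤ 1} with hT
  have hK : IsCompact (P ×ˢ T) := (isCompact_Icc.prod isCompact_Icc).prod (isCompact_momBox _ _ _)
  obtain ⟨B, hB⟩ := hK.exists_bound_of_continuousOn ((hF.continuous_iteratedFDeriv (m := m) (by exact_mod_cast le_top)).continuousOn)
  refine ⟨max B 0, le_max_right _ _, fun s θ hs hs1 t => ?_⟩
  have hsub := tsupport_rescaled_subset hu hs hs1 θ
  rw [rescaled_eq_slice hu hs hs1 θ] at hsub ⊢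
  have hp : (((0 : ℝ), s) : ℝ × ℝ) ∈ P := ⟨⟨le_rfl, le_rfl⟩, ⟨hs.le, hs1⟩⟩
  by_cases ht : t ∈ T
  · -- on the box: the compactness bound for the slice
    exact ((norm_iteratedFDeriv_slice_le hF (0, s) m t).trans (hB _ (mk_mem_prod hp ht))).trans (le_max_left _ _)
  · -- off the box: the symbol vanishes identically near `t`
    have h0 : iteratedFDeriv ℝ m (fun t : MomSpace => (fun q : (ℝ × ℝ) × MomSpace =>
        ((u (q.2 0 ^ 2 + (2 * q.2 1 + q.1.2 ^ 2 * q.2 1 ^ 2 + q.2 2 ^ 2) ^ 2) *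
            truncOne (1 / 2) (Real.cos (3 * Real.pi / 4)) (Real.cos (7 * Real.pi / 8))
              (((1 + q.1.2 ^ 2 * q.2 1 : ℝ) : ℂ) + ((q.1.2 * q.2 2 : ℝ) : ℂ) * I) *
            u (slopeQuot (fun p : MomSpace × ℝ =>
                truncArg (1 / 4) (Real.cos (7 * Real.pi / 8)) (Real.cos (15 * Real.pi / 16))
                  (((1 + p.2 ^ 2 * p.1 1 : ℝ) : ℂ) + ((p.2 * p.1 2 : ℝ) : ℂ) * I)) (q.2, q.1.2)) : ℝ) : ℂ))
        (((0 : ℝ), s), t)) t = 0 := by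
      by_contra hne
      exact ht (hsub (support_iteratedFDeriv_subset m (Function.mem_support.2 hne)))
    rw [h0, norm_zero]
    positivity

/-! ## 5. Fourier decay of the rescaled symbol, uniformly in the scale and the sector -/

/-- **Four integrations by parts, uniformly in `Λ` and `θ`**: `‖𝓕R_{s,θ}(y)‖ ≤ K₁ (1 + ‖y‖)^{-4}` for all
`0 < s ≤ 1`, `θ`, `y`. [cite: DisertoriRivasseau2000, §IV.2.1 Lemma 5 p0013:L38–61] -/
private theorem fourier_rescaled_decay {u : ℝ → ℝ} (hu : IsCutoff u) :
    ∃ K₁ : ℝ, 0 ≤ K₁ ∧ ∀ (s θ : ℝ), 0 < s → s ≤ 1 → ∀ y : MomSpace,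
      ‖𝓕 (fun t : MomSpace => ((sectorChiMom u (1 / (s ^ 2) ^ 2) θ
          ![Real.cos θ + s ^ 2 * t 1 * Real.cos θ - s * t 2 * Real.sin θ,
            Real.sin θ + s ^ 2 * t 1 * Real.sin θ + s * t 2 * Real.cos θ] *
        u (rOf (s ^ 2 * t 0, ![Real.cos θ + s ^ 2 * t 1 * Real.cos θ - s * t 2 * Real.sin θ,
            Real.sin θ + s ^ 2 * t 1 * Real.sin θ + s * t 2 * Real.cos θ]) / (s ^ 2) ^ 2) : ℝ) : ℂ)) y‖ ≤
        K₁ * ((1 + ‖y‖) ^ 4)⁻¹ := by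
  choose B hB0 hB using fun m => exists_iteratedFDeriv_rescaled_le hu m
  set Bs : ℝ := ∑ m ∈ Finset.range 5, B m with hBs
  have hBs0 : 0 ≤ Bs := Finset.sum_nonneg fun m _ => hB0 m
  have hBle : ∀ m ≤ 4, B m ≤ Bs := fun m hm =>
    Finset.single_le_sum (fun k _ => hB0 k) (Finset.mem_range.2 (by omega))
  set T : Set MomSpace := {t | |t 0| ≤ 1 ∧ |t 1| ≤ 2 ∧ |t 2| ≤ 1} with hT
  have hTc : IsCompact T := isCompact_momBox _ _ _
  have hvol0 : 0 ≤ (volume T).toReal := ENNReal.toReal_nonneg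
  refine ⟨2 ^ 4 * (Bs * (volume T).toReal), by positivity, fun s θ hs hs1 y => ?_⟩
  have hsub := tsupport_rescaled_subset hu hs hs1 θ
  exact norm_fourier_le_of_iteratedFDeriv_le (contDiff_rescaled hu hs hs1 θ)
    (hTc.of_isClosed_subset (isClosed_tsupport _) hsub) (N := 4)
    (fun n hn x => (hB n s θ hs hs1 x).trans (hBle n hn))
    (ENNReal.toReal_mono hTc.measure_lt_top.ne (measure_mono hsub)) y

/-! ## 6. The `T = 0` kernel as a Fourier transform on `ℝ³`; the anisotropic chart and the decay transfer -/

/-- **The `T = 0` kernel is a Fourier transform**: `C₀[a](x) = (2π)^{-3} 𝓕(a ∘ split)(ξ)` at the dual point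
`ξ = (x₀, −x⃗)/(2π)` (the pairing `kx = −k₀x₀ + k⃗·x⃗` of (II.5) is `−2π⟨split⁻¹k, ξ⟩`).
[cite: DisertoriRivasseau2000, §II.1 (II.5)–(II.6) p0003:L64–95] -/
private theorem zeroKernel_eq_fourier (a : Mom → ℂ) (x : Mom) :
    zeroKernel a x = ((1 / (2 * Real.pi) ^ 3 : ℝ) : ℂ) * 𝓕 (fun q : MomSpace => a (splitMomentum q)) (dualPoint x.1 x.2) := by
  rw [zeroKernel, Real.fourier_eq', ← measurePreserving_splitMomentum.integral_comp splitMomentum.measurableEmbedding]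
  congr 1
  refine integral_congr_ae (ae_of_all _ fun q => ?_)
  simp only [splitMomentum_apply, smul_eq_mul, pairing, Matrix.cons_val_zero, Matrix.cons_val_one]
  congr 2
  rw [inner_E3]
  simp only [dualPoint, PiLp.toLp_apply, Matrix.cons_val_zero, Matrix.cons_val_one, Matrix.cons_val_two,
    Matrix.tail_cons, Matrix.head_cons]
  push_cast
  field_simp
  ring

/-- **The anisotropic chart of the sector** `t ↦ (s²t₀, s²t₁ e(θ) + s t₂ τ(θ))` as a continuous linear automorphism
of `ℝ³`: its matrix has determinant `s²·s²·s` (`e ⊥ τ` orthonormal), and its adjoint is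
`w ↦ (s²w₀, s²⟨e, w⃗⟩, s⟨τ, w⃗⟩)` (the dual scales). [cite: DisertoriRivasseau2000, §IV.2.1 Lemma 5 p0013:L50–61] -/
private theorem exists_chart {s : ℝ} (hs : 0 < s) (θ : ℝ) :
    ∃ A : MomSpace ≃L[ℝ] MomSpace,
      (∀ t : MomSpace, A t = WithLp.toLp 2 ![s ^ 2 * t 0,
        s ^ 2 * Real.cos θ * t 1 + -(s * Real.sin θ) * t 2, s ^ 2 * Real.sin θ * t 1 + s * Real.cos θ * t 2]) ∧
      LinearMap.det ((A.symm : MomSpace ≃ₗ[ℝ] MomSpace) : MomSpace →ₗ[ℝ] MomSpace) = (s ^ 2 * s ^ 2 * s)⁻¹ ∧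
      ∀ w : MomSpace, ContinuousLinearMap.adjoint (A : MomSpace →L[ℝ] MomSpace) w =
        WithLp.toLp 2 ![s ^ 2 * w 0, s ^ 2 * (Real.cos θ * w 1 + Real.sin θ * w 2),
          s * (-Real.sin θ * w 1 + Real.cos θ * w 2)] := by
  set Mx : Matrix (Fin 3) (Fin 3) ℝ :=
    !![s ^ 2, 0, 0; 0, s ^ 2 * Real.cos θ, -(s * Real.sin θ); 0, s ^ 2 * Real.sin θ, s * Real.cos θ] with hMx
  have hdetM : Mx.det = s ^ 2 * s ^ 2 * s := by
    rw [hMx, Matrix.det_fin_three]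
    simp only [Matrix.of_apply, Matrix.cons_val', Matrix.cons_val_zero, Matrix.cons_val_one, Matrix.cons_val_two,
      Matrix.empty_val', Matrix.cons_val_fin_one, Matrix.head_cons, Matrix.tail_cons, Matrix.head_fin_const]
    linear_combination (s ^ 2 * s ^ 2 * s) * Real.sin_sq_add_cos_sq θ
  set L : MomSpace →ₗ[ℝ] MomSpace := Matrix.toEuclideanLin Mx with hL
  have hdetL : LinearMap.det L = s ^ 2 * s ^ 2 * s := by
    rw [hL, Matrix.toEuclideanLin, ← hdetM]
    exact LinearMap.det_toLpLin 2 _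
  have hdet0 : LinearMap.det L ≠ 0 := by rw [hdetL]; positivity
  set A : MomSpace ≃L[ℝ] MomSpace := (LinearMap.equivOfDetNeZero L hdet0).toContinuousLinearEquiv with hA
  have hAapp : ∀ t : MomSpace, A t = WithLp.toLp 2 ![s ^ 2 * t 0,
      s ^ 2 * Real.cos θ * t 1 + -(s * Real.sin θ) * t 2, s ^ 2 * Real.sin θ * t 1 + s * Real.cos θ * t 2] := by
    intro t
    change L t = _
    rw [hL, Matrix.toEuclideanLin, Matrix.toLpLin_apply]
    congr 1
    funext i
    fin_cases i <;> simp [hMx, Matrix.mulVec, dotProduct, Fin.sum_univ_three]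
  have hdetA : LinearMap.det ((A : MomSpace ≃ₗ[ℝ] MomSpace) : MomSpace →ₗ[ℝ] MomSpace) = s ^ 2 * s ^ 2 * s := by
    rw [← hdetL]; rfl
  refine ⟨A, hAapp, ?_, fun w => ?_⟩
  · rw [← hdetA]; exact LinearEquiv.det_coe_symm _
  · refine ext_inner_right ℝ fun t => ?_
    rw [ContinuousLinearMap.adjoint_inner_left, ContinuousLinearEquiv.coe_coe, hAapp, inner_E3, inner_E3]
    simp only [Matrix.cons_val_zero, Matrix.cons_val_one, Matrix.cons_val_two, Matrix.tail_cons, Matrix.head_cons]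
    ring

/-- In the chart, a symbol on `ℝ × ℝ²` factors through the rescaled symbol: `a ∘ split = (R ∘ A⁻¹) ∘ (· − q_F)` with
the base point `q_F = (0, e(θ))` and `R(t) = a(s²t₀, (1 + s²t₁)e(θ) + s t₂ τ(θ))`. [folklore] -/
private theorem symbol_comp_split_eq (a : Mom → ℂ) {s : ℝ} (θ : ℝ) {A : MomSpace ≃L[ℝ] MomSpace}
    (hA : ∀ t : MomSpace, A t = WithLp.toLp 2 ![s ^ 2 * t 0,
        s ^ 2 * Real.cos θ * t 1 + -(s * Real.sin θ) * t 2, s ^ 2 * Real.sin θ * t 1 + s * Real.cos θ * t 2]) :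
    (fun q : MomSpace => a (splitMomentum q)) =
      ((fun t : MomSpace => a (s ^ 2 * t 0,
          ![Real.cos θ + s ^ 2 * t 1 * Real.cos θ - s * t 2 * Real.sin θ,
            Real.sin θ + s ^ 2 * t 1 * Real.sin θ + s * t 2 * Real.cos θ])) ∘ A.symm) ∘
        fun q => q + -(WithLp.toLp 2 ![0, Real.cos θ, Real.sin θ] : MomSpace) := by
  have hR : ∀ t : MomSpace, a (s ^ 2 * t 0,
      ![Real.cos θ + s ^ 2 * t 1 * Real.cos θ - s * t 2 * Real.sin θ,
        Real.sin θ + s ^ 2 * t 1 * Real.sin θ + s * t 2 * Real.cos θ]) =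
      a (splitMomentum ((WithLp.toLp 2 ![0, Real.cos θ, Real.sin θ] : MomSpace) + A t)) := by
    intro t
    rw [hA, splitMomentum_apply]
    congr 1
    refine Prod.ext ?_ ?_
    · simp
    · ext i
      fin_cases i <;> simp <;> ring
  funext q
  simp only [Function.comp_apply]
  rw [hR, ContinuousLinearEquiv.apply_symm_apply]
  congr 2
  abel

/-- **Decay transfer (the change of variables).** If the rescaled symbol `R_{s,θ}` of `a` has Fourier decay
`‖𝓕R(y)‖ ≤ K(1 + ‖y‖)^{-N}`, then `|C₀[a](x)| ≤ (2π)^{-3} · s²s²s · K · (1 + ‖(s²x₀, −s²x_r, −s x_t)/(2π)‖)^{-N}`: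
the Jacobian `Λ·Λ·Λ^{1/2}` and the dual scales. [cite: DisertoriRivasseau2000, §IV.2.1 Lemma 5 p0013:L50–61] -/
private theorem norm_zeroKernel_le_of_fourier_decay (a : Mom → ℂ) {s K : ℝ} (hs : 0 < s) (θ : ℝ) {N : ℕ}
    (hK : ∀ y : MomSpace, ‖𝓕 (fun t : MomSpace => a (s ^ 2 * t 0,
        ![Real.cos θ + s ^ 2 * t 1 * Real.cos θ - s * t 2 * Real.sin θ,
          Real.sin θ + s ^ 2 * t 1 * Real.sin θ + s * t 2 * Real.cos θ])) y‖ ≤ K * ((1 + ‖y‖) ^ N)⁻¹)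
    (x : Mom) :
    ‖zeroKernel a x‖ ≤ 1 / (2 * Real.pi) ^ 3 * (s ^ 2 * s ^ 2 * s) *
      (K * ((1 + ‖(WithLp.toLp 2 ![s ^ 2 * dualPoint x.1 x.2 0,
          s ^ 2 * (Real.cos θ * dualPoint x.1 x.2 1 + Real.sin θ * dualPoint x.1 x.2 2),
          s * (-Real.sin θ * dualPoint x.1 x.2 1 + Real.cos θ * dualPoint x.1 x.2 2)] : MomSpace)‖) ^ N)⁻¹) := by
  obtain ⟨A, hA, hdet, hadj⟩ := exists_chart hs θ
  rw [zeroKernel_eq_fourier, symbol_comp_split_eq a θ hA, norm_mul, norm_fourier_comp_add_right, Complex.norm_real,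
    Real.norm_eq_abs, abs_of_pos (by positivity)]
  have h := norm_fourier_comp_continuousLinearEquiv_le A.symm hK (dualPoint x.1 x.2)
  rw [ContinuousLinearEquiv.symm_symm, hadj, hdet, inv_inv, abs_of_pos (by positivity)] at h
  rw [mul_assoc]
  exact mul_le_mul_of_nonneg_left h (by positivity)

/-- **The root symbol is smooth on `ℝ × ℝ²`** (`0 < Λ = s² ≤ 1`): it is the rescaled symbol composed with the
(affine) inverse chart. [cite: DisertoriRivasseau2000, §IV.2.1 (IV.19) p0013:L27–29] -/
private theorem contDiff_rootSymbol {u : ℝ → ℝ} (hu : IsCutoff u) {s : ℝ} (hs : 0 < s) (hs1 : s ≤ 1) (θ : ℝ) :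
    ContDiff ℝ ∞ fun k : Mom => ((sectorChiMom u (1 / (s ^ 2) ^ 2) θ k.2 * u (rOf k / (s ^ 2) ^ 2) : ℝ) : ℂ) := by
  have hs0 : s ≠ 0 := hs.ne'
  -- the inverse chart `k ↦ (k₀/s², (⟨e, k⃗⟩ − 1)/s², ⟨τ, k⃗⟩/s)`
  have hT : ContDiff ℝ ∞ fun k : Mom => (WithLp.toLp 2 ![k.1 / s ^ 2,
      (Real.cos θ * k.2 0 + Real.sin θ * k.2 1 - 1) / s ^ 2, (-Real.sin θ * k.2 0 + Real.cos θ * k.2 1) / s] : MomSpace) := by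
    refine contDiff_piLp' 2 fun i => ?_
    have h0 : ContDiff ℝ ∞ fun k : Mom => k.2 0 := (contDiff_apply ℝ ℝ (0 : Fin 2)).comp contDiff_snd
    have h1 : ContDiff ℝ ∞ fun k : Mom => k.2 1 := (contDiff_apply ℝ ℝ (1 : Fin 2)).comp contDiff_snd
    fin_cases i
    · simpa using contDiff_fst.div_const (s ^ 2)
    · simpa using (((contDiff_const.mul h0).add (contDiff_const.mul h1)).sub contDiff_const).div_const (s ^ 2)
    · simpa using (((contDiff_const (c := Real.sin θ)).mul h0).neg.add (contDiff_const.mul h1)).div_const s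
  have hcomp := (contDiff_rescaled hu hs hs1 θ).comp hT
  refine contDiff_iff_contDiffAt.2 fun k₀ => hcomp.contDiffAt.congr_of_eventuallyEq (Eventually.of_forall fun k => ?_)
  simp only [Function.comp_apply, Matrix.cons_val_zero, Matrix.cons_val_one, Matrix.cons_val_two,
    Matrix.tail_cons, Matrix.head_cons]
  have h1 : s ^ 2 * (k.1 / s ^ 2) = k.1 := by field_simp
  have h2 : ![Real.cos θ + s ^ 2 * ((Real.cos θ * k.2 0 + Real.sin θ * k.2 1 - 1) / s ^ 2) * Real.cos θ -
        s * ((-Real.sin θ * k.2 0 + Real.cos θ * k.2 1) / s) * Real.sin θ,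
      Real.sin θ + s ^ 2 * ((Real.cos θ * k.2 0 + Real.sin θ * k.2 1 - 1) / s ^ 2) * Real.sin θ +
        s * ((-Real.sin θ * k.2 0 + Real.cos θ * k.2 1) / s) * Real.cos θ] = k.2 := by
    ext i
    fin_cases i
    · simp only [Fin.zero_eta, Fin.isValue, Matrix.cons_val_zero]
      field_simp
      linear_combination (k.2 0) * Real.sin_sq_add_cos_sq θ
    · simp only [Fin.mk_one, Fin.isValue, Matrix.cons_val_one, Matrix.cons_val_zero]
      field_simp
      linear_combination (k.2 1) * Real.sin_sq_add_cos_sq θ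
  rw [h1, h2, Prod.mk.eta]

/-- **The root symbol has compact support** (`0 < Λ = s² ≤ 1`): `u(r/Λ²) ≠ 0` forces `r ≤ Λ²/2 ≤ 1/2`, hence
`|k₀| ≤ 2` and `|k⃗_i| ≤ 2`. [cite: DisertoriRivasseau2000, §II.2 (II.12)–(II.13) p0004:L10–16] -/
private theorem hasCompactSupport_rootSymbol {u : ℝ → ℝ} (hu : IsCutoff u) {s : ℝ} (hs : 0 < s) (hs1 : s ≤ 1) (θ : ℝ) :
    HasCompactSupport fun k : Mom => ((sectorChiMom u (1 / (s ^ 2) ^ 2) θ k.2 * u (rOf k / (s ^ 2) ^ 2) : ℝ) : ℂ) := by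
  refine HasCompactSupport.intro (isCompact_closedBall (0 : Mom) 2) fun k hk => ?_
  rw [Metric.mem_closedBall, dist_zero_right, not_le] at hk
  have hs2 : s ^ 2 ≤ 1 := by nlinarith
  have hss : 0 < (s ^ 2) ^ 2 := by positivity
  -- off the ball some coordinate exceeds `2`, so `r > 1/2 ≥ Λ²/2`
  have hr : (s ^ 2) ^ 2 / 2 < rOf k := by
    by_contra hcon
    rw [not_lt] at hcon
    have hr' : k.1 ^ 2 + (k.2 0 ^ 2 + k.2 1 ^ 2 - 1) ^ 2 ≤ 1 / 2 := by
      have : rOf k = k.1 ^ 2 + (k.2 0 ^ 2 + k.2 1 ^ 2 - 1) ^ 2 := by rw [rOf, dispersion]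
      nlinarith
    have hk1 : |k.1| ≤ 2 :=
      abs_le.2 (abs_le_of_sq_le_sq' (by nlinarith [sq_nonneg (k.2 0 ^ 2 + k.2 1 ^ 2 - 1)]) (by norm_num))
    have hw : k.2 0 ^ 2 + k.2 1 ^ 2 ≤ 4 := by nlinarith [sq_nonneg k.1]
    have hk2 : ∀ i : Fin 2, |k.2 i| ≤ 2 := by
      intro i
      refine abs_le.2 (abs_le_of_sq_le_sq' ?_ (by norm_num))
      fin_cases i
      · simp only [Fin.zero_eta, Fin.isValue]; nlinarith [sq_nonneg (k.2 1)]
      · simp only [Fin.mk_one, Fin.isValue]; nlinarith [sq_nonneg (k.2 0)]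
    have hnorm : ‖k‖ ≤ 2 := by
      rw [Prod.norm_def]
      refine max_le (by rw [Real.norm_eq_abs]; exact hk1) ((pi_norm_le_iff_of_nonneg (by norm_num)).2 fun i => ?_)
      rw [Real.norm_eq_abs]
      exact hk2 i
    linarith
  have hu0 : u (rOf k / (s ^ 2) ^ 2) = 0 := by
    apply hu.eq_zero
    rw [abs_of_nonneg (div_nonneg (by rw [rOf]; positivity) hss.le), lt_div_iff₀ hss]
    linarith
  rw [hu0, mul_zero, Complex.ofReal_zero]

/-! ## 7. The `T = 0` decay estimate and the proof of Lemma 5 -/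

/-- **The anisotropic decay of the `T = 0` root kernel**: there is `K` (depending on the cutoff `u` only) with
`|η⁰_θ(x)| ≤ K Λ^{5/2}/[1 + Λ²x₀² + Λ²x_r² + Λx_t²]²` for all `0 < Λ ≤ 1`, all sector centres `θ` and all `x`, where
`η̂⁰_θ(k) = χ_θ(θ(k⃗)) u(r/Λ²)` and `x_r = x⃗·e(θ)`, `x_t = x⃗·τ(θ)`.
[cite: DisertoriRivasseau2000, §IV.2.1 Lemma 5 p0013:L38–61] -/
private theorem zero_decay {u : ℝ → ℝ} (hu : IsCutoff u) :
    ∃ K : ℝ, 0 < K ∧ ∀ (L θ : ℝ), 0 < L → L ≤ 1 → ∀ x : Mom,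
      ‖zeroKernel (fun k : Mom => ((sectorChiMom u (1 / L ^ 2) θ k.2 * u (rOf k / L ^ 2) : ℝ) : ℂ)) x‖ ≤
        K * L ^ (5 / 2 : ℝ) / (1 + L ^ 2 * x.1 ^ 2 + L ^ 2 * (x.2 0 * Real.cos θ + x.2 1 * Real.sin θ) ^ 2 +
          L * (-x.2 0 * Real.sin θ + x.2 1 * Real.cos θ) ^ 2) ^ 2 := by
  obtain ⟨K₁, hK₁0, hK₁⟩ := fourier_rescaled_decay hu
  have hπ := Real.pi_pos
  have hπ3 := Real.pi_gt_three
  refine ⟨1 / (2 * Real.pi) ^ 3 * K₁ * (4 * Real.pi ^ 2) ^ 2 + 1, by positivity, fun L θ hL hL1 x => ?_⟩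
  -- `Λ = s²`
  set s : ℝ := Real.sqrt L with hs_def
  have hs : 0 < s := Real.sqrt_pos.2 hL
  have hsL : s ^ 2 = L := Real.sq_sqrt hL.le
  have hs1 : s ≤ 1 := by rw [hs_def, ← Real.sqrt_one]; exact Real.sqrt_le_sqrt hL1
  rw [← hsL]
  -- the transfer of the uniform Fourier decay through the chart
  have h := norm_zeroKernel_le_of_fourier_decay
    (fun k : Mom => ((sectorChiMom u (1 / (s ^ 2) ^ 2) θ k.2 * u (rOf k / (s ^ 2) ^ 2) : ℝ) : ℂ)) hs θ
    (hK₁ s θ hs hs1) x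
  refine h.trans ?_
  -- the dual point: `‖v‖² = (Λ²x₀² + Λ²x_r² + Λx_t²)/(4π²)`
  set v : MomSpace := WithLp.toLp 2 ![s ^ 2 * dualPoint x.1 x.2 0,
      s ^ 2 * (Real.cos θ * dualPoint x.1 x.2 1 + Real.sin θ * dualPoint x.1 x.2 2),
      s * (-Real.sin θ * dualPoint x.1 x.2 1 + Real.cos θ * dualPoint x.1 x.2 2)] with hv
  set D : ℝ := 1 + (s ^ 2) ^ 2 * x.1 ^ 2 + (s ^ 2) ^ 2 * (x.2 0 * Real.cos θ + x.2 1 * Real.sin θ) ^ 2 +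
      s ^ 2 * (-x.2 0 * Real.sin θ + x.2 1 * Real.cos θ) ^ 2 with hD
  have hv2 : ‖v‖ ^ 2 = ((s ^ 2) ^ 2 * x.1 ^ 2 + (s ^ 2) ^ 2 * (x.2 0 * Real.cos θ + x.2 1 * Real.sin θ) ^ 2 +
      s ^ 2 * (-x.2 0 * Real.sin θ + x.2 1 * Real.cos θ) ^ 2) / (4 * Real.pi ^ 2) := by
    rw [EuclideanSpace.norm_eq, Real.sq_sqrt (Finset.sum_nonneg fun i _ => sq_nonneg _), Fin.sum_univ_three]
    simp only [hv, PiLp.toLp_apply, Matrix.cons_val_zero, Matrix.cons_val_one, Matrix.cons_val_two, Matrix.tail_cons,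
      Matrix.head_cons, dualPoint, Real.norm_eq_abs, sq_abs]
    field_simp
    ring
  have hDv : D = 1 + 4 * Real.pi ^ 2 * ‖v‖ ^ 2 := by
    rw [hv2, hD]
    field_simp
    ring
  have hn : 0 ≤ ‖v‖ := norm_nonneg _
  have hDpos : 0 < D := by rw [hDv]; positivity
  have hπ2 : 1 ≤ 4 * Real.pi ^ 2 := by nlinarith
  have hDle : D ≤ 4 * Real.pi ^ 2 * (1 + ‖v‖) ^ 2 := by
    rw [hDv]
    nlinarith [mul_nonneg (mul_nonneg (by norm_num : (0 : ℝ) ≤ 4) (sq_nonneg Real.pi)) hn]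
  have hD2 : D ^ 2 ≤ (4 * Real.pi ^ 2) ^ 2 * (1 + ‖v‖) ^ 4 := by
    calc D ^ 2 ≤ (4 * Real.pi ^ 2 * (1 + ‖v‖) ^ 2) ^ 2 := pow_le_pow_left₀ hDpos.le hDle 2
      _ = (4 * Real.pi ^ 2) ^ 2 * (1 + ‖v‖) ^ 4 := by ring
  have key : ((1 + ‖v‖) ^ 4)⁻¹ ≤ (4 * Real.pi ^ 2) ^ 2 / D ^ 2 := by
    rw [inv_eq_one_div, div_le_div_iff₀ (by positivity) (by positivity), one_mul]
    exact hD2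
  have h52 : (s ^ 2) ^ (5 / 2 : ℝ) = s ^ 2 * s ^ 2 * s := by
    conv_lhs => rw [← Real.rpow_two, ← Real.rpow_mul hs.le, show (2 : ℝ) * (5 / 2) = ((5 : ℕ) : ℝ) by norm_num,
      Real.rpow_natCast]
    ring
  rw [h52]
  calc 1 / (2 * Real.pi) ^ 3 * (s ^ 2 * s ^ 2 * s) * (K₁ * ((1 + ‖v‖) ^ 4)⁻¹)
      ≤ 1 / (2 * Real.pi) ^ 3 * (s ^ 2 * s ^ 2 * s) * (K₁ * ((4 * Real.pi ^ 2) ^ 2 / D ^ 2)) := by gcongr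
    _ = (1 / (2 * Real.pi) ^ 3 * K₁ * (4 * Real.pi ^ 2) ^ 2) * (s ^ 2 * s ^ 2 * s) / D ^ 2 := by ring
    _ ≤ (1 / (2 * Real.pi) ^ 3 * K₁ * (4 * Real.pi ^ 2) ^ 2 + 1) * (s ^ 2 * s ^ 2 * s) / D ^ 2 := by
        gcongr; linarith

set_option maxHeartbeats 400000 in
/-- **Lemma 5 of Disertori–Rivasseau 2000, Part I (§IV.2.1), in the typed (`m/T`-shift) form**: for every cutoff `u`
of (II.13) there is `K` (depending on `u` only) such that for all `0 ≤ Λ ≤ 1`, `T > 0`, sector centres `θ` and `z`,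
`|η_θ(z)| ≤ K Σ_{m∈ℤ} Λ_T^{5/2}/[1 + Λ_T²(z₀ + m/T)² + Λ_T² z_r² + Λ_T z_t²]²`, `Λ_T = max(Λ, √2πT)` — the decay of
the `T = 0` kernel through the sector change of variables (curvature ⇒ the sector length `Λ_T^{1/2}`), transported to
`T > 0` by the antiperiodisation (II.9) (Lemma 1). [cite: DisertoriRivasseau2000, §IV.2.1 Lemma 5 (IV.19)–(IV.20) p0013:L27–78] -/
theorem Lemma5RootTestFunctionDecay_holds : Lemma5RootTestFunctionDecay := by
  intro u hu
  obtain ⟨K, hK0, hK⟩ := zero_decay hu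
  refine ⟨K, hK0, fun Λ T θs hΛ0 hΛ1 hT z => ?_⟩
  have hπ := Real.pi_pos
  have hLT0 : 0 ≤ lambdaT Λ T := le_max_of_le_left hΛ0
  -- the majorant is termwise nonnegative
  have hg0 : ∀ m : ℤ, 0 ≤ lambdaT Λ T ^ (5 / 2 : ℝ) /
      (1 + lambdaT Λ T ^ 2 * (z.1 + (m : ℝ) / T) ^ 2 +
          lambdaT Λ T ^ 2 * (z.2 0 * Real.cos θs + z.2 1 * Real.sin θs) ^ 2 +
          lambdaT Λ T * (-z.2 0 * Real.sin θs + z.2 1 * Real.cos θs) ^ 2) ^ 2 :=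
    fun m => div_nonneg (Real.rpow_nonneg hLT0 _) (sq_nonneg _)
  by_cases hcase : Λ ≤ Real.sqrt 2 * Real.pi * T
  · /- Regime (A), `√2πT ≥ Λ`: `Λ_T = √2πT` and every Matsubara frequency lies outside the cutoff, `k₀² ≥ π²T² =
    Λ_T²/2`, so `η_θ ≡ 0`. -/
    have hΛT : lambdaT Λ T = Real.sqrt 2 * Real.pi * T := max_eq_right hcase
    have hvan : ∀ (n : ℤ) (k : Fin 2 → ℝ), etaSymbol u Λ T θs (matsubaraMom T n k) = 0 := by
      intro n k
      have h2 : Real.sqrt 2 ^ 2 = 2 := Real.sq_sqrt (by norm_num)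
      have hn : (1 : ℝ) ≤ (2 * (n : ℝ) + 1) ^ 2 := by
        rw [one_le_sq_iff_one_le_abs]
        exact_mod_cast Int.one_le_abs (show (2 * n + 1 : ℤ) ≠ 0 by omega)
      have hr : 1 / 2 ≤ |rOf (matsubaraMom T n k) / lambdaT Λ T ^ 2| := by
        rw [abs_of_nonneg (by rw [rOf]; positivity), le_div_iff₀ (by rw [hΛT]; positivity), rOf, matsubaraMom_fst, hΛT]
        have h1 : 1 / 2 * (Real.sqrt 2 * Real.pi * T) ^ 2 = 1 * (Real.pi * T) ^ 2 := by rw [mul_pow, mul_pow, h2]; ring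
        rw [h1, show ((2 * (n : ℝ) + 1) * Real.pi * T) ^ 2 = (2 * (n : ℝ) + 1) ^ 2 * (Real.pi * T) ^ 2 by ring]
        nlinarith [sq_nonneg (Real.pi * T), sq_nonneg (dispersion (matsubaraMom T n k).2),
          mul_le_mul_of_nonneg_right hn (sq_nonneg (Real.pi * T))]
      rw [etaSymbol, cutoff_eq_zero_of_half_le hu hr, mul_zero, Complex.ofReal_zero]
    have hzero : thermalKernel T (etaSymbol u Λ T θs) z = 0 := by
      simp only [thermalKernel, hvan, mul_zero, integral_zero, tsum_zero]
    rw [hzero, norm_zero]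
    exact mul_nonneg hK0.le (tsum_nonneg hg0)
  · /- Regime (B), `Λ > √2πT`: `Λ_T = Λ ∈ (0, 1]`; Lemma 1 and the `T = 0` decay. -/
    push Not at hcase
    have hΛT : lambdaT Λ T = Λ := max_eq_left hcase.le
    have hΛpos : 0 < Λ := lt_of_le_of_lt (by positivity) hcase
    have hη : etaSymbol u Λ T θs = fun k : Mom => ((sectorChiMom u (1 / Λ ^ 2) θs k.2 * u (rOf k / Λ ^ 2) : ℝ) : ℂ) := by
      funext k; rw [etaSymbol, hΛT]
    -- smoothness and compact support (through `Λ = s²`)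
    set s : ℝ := Real.sqrt Λ with hs_def
    have hs : 0 < s := Real.sqrt_pos.2 hΛpos
    have hsL : s ^ 2 = Λ := Real.sq_sqrt hΛ0
    have hs1 : s ≤ 1 := by rw [hs_def, ← Real.sqrt_one]; exact Real.sqrt_le_sqrt hΛ1
    have hcd : ContDiff ℝ ((⊤ : ℕ∞) : WithTop ℕ∞) (etaSymbol u Λ T θs) := by
      rw [hη, ← hsL]; exact contDiff_rootSymbol hu hs hs1 θs
    have hcs : HasCompactSupport (etaSymbol u Λ T θs) := by
      rw [hη, ← hsL]; exact hasCompactSupport_rootSymbol hu hs hs1 θs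
    -- Lemma 1 (II.9): the antiperiodisation
    rw [Lemma1Antiperiodisation_holds _ hcd hcs T hT z, hΛT]
    -- the termwise bound by the `T = 0` decay
    set g : ℤ → ℝ := fun m => Λ ^ (5 / 2 : ℝ) /
      (1 + Λ ^ 2 * (z.1 + (m : ℝ) / T) ^ 2 + Λ ^ 2 * (z.2 0 * Real.cos θs + z.2 1 * Real.sin θs) ^ 2 +
          Λ * (-z.2 0 * Real.sin θs + z.2 1 * Real.cos θs) ^ 2) ^ 2 with hg
    have hterm : ∀ m : ℤ, ‖(-1 : ℂ) ^ m * zeroKernel (etaSymbol u Λ T θs) (z.1 + (m : ℝ) / T, z.2)‖ ≤ K * g m := by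
      intro m
      rw [norm_mul, norm_zpow, norm_neg, norm_one, one_zpow, one_mul, hη, hg]
      simp only
      rw [mul_div_assoc']
      exact hK Λ θs hΛpos hΛ1 (z.1 + (m : ℝ) / T, z.2)
    -- the majorant is summable (it is `O(m⁻⁴)`)
    have hev : ∀ᶠ m : ℤ in cofinite, 1 ≤ |(m : ℝ) + T * z.1| := by
      rw [Filter.eventually_cofinite]
      refine (Set.finite_Icc (⌊-(T * z.1)⌋ - 1) (⌈-(T * z.1)⌉ + 1)).subset fun m hm => ?_
      simp only [Set.mem_setOf_eq, not_le] at hm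
      obtain ⟨h1, h2⟩ := abs_lt.1 hm
      have hf := Int.floor_le (-(T * z.1))
      have hc := Int.le_ceil (-(T * z.1))
      constructor
      · have h3 : ((⌊-(T * z.1)⌋ : ℤ) : ℝ) < (m : ℝ) + 1 := by linarith
        have h4 : ⌊-(T * z.1)⌋ < m + 1 := by exact_mod_cast h3
        omega
      · have h3 : (m : ℝ) - 1 < ((⌈-(T * z.1)⌉ : ℤ) : ℝ) := by linarith
        have h4 : m - 1 < ⌈-(T * z.1)⌉ := by exact_mod_cast h3
        omega
    have hmaj : ∀ m : ℤ, 1 ≤ |(m : ℝ) + T * z.1| →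
        g m ≤ Λ ^ (5 / 2 : ℝ) * T ^ 2 / Λ ^ 2 * (1 / |(m : ℝ) + T * z.1| ^ (2 : ℝ)) := by
      intro m hm
      rw [Real.rpow_two, sq_abs, hg]
      simp only
      have hw : 1 ≤ ((m : ℝ) + T * z.1) ^ 2 := by
        rw [one_le_sq_iff_one_le_abs]; exact hm
      set Dm : ℝ := 1 + Λ ^ 2 * (z.1 + (m : ℝ) / T) ^ 2 + Λ ^ 2 * (z.2 0 * Real.cos θs + z.2 1 * Real.sin θs) ^ 2 +
        Λ * (-z.2 0 * Real.sin θs + z.2 1 * Real.cos θs) ^ 2 with hDm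
      have hD1 : 1 ≤ Dm := by
        rw [hDm]
        nlinarith [sq_nonneg (z.1 + (m : ℝ) / T), sq_nonneg (z.2 0 * Real.cos θs + z.2 1 * Real.sin θs),
          sq_nonneg (-z.2 0 * Real.sin θs + z.2 1 * Real.cos θs), sq_nonneg Λ]
      have hDw : Λ ^ 2 / T ^ 2 * ((m : ℝ) + T * z.1) ^ 2 ≤ Dm := by
        have he : Λ ^ 2 * (z.1 + (m : ℝ) / T) ^ 2 = Λ ^ 2 / T ^ 2 * ((m : ℝ) + T * z.1) ^ 2 := by
          field_simp
          ring
        rw [hDm, ← he]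
        nlinarith [sq_nonneg (z.2 0 * Real.cos θs + z.2 1 * Real.sin θs),
          sq_nonneg (-z.2 0 * Real.sin θs + z.2 1 * Real.cos θs), sq_nonneg Λ]
      have hD2 : Dm ≤ Dm ^ 2 := by nlinarith
      have hwpos : 0 < Λ ^ 2 / T ^ 2 * ((m : ℝ) + T * z.1) ^ 2 := by positivity
      calc Λ ^ (5 / 2 : ℝ) / Dm ^ 2 ≤ Λ ^ (5 / 2 : ℝ) / (Λ ^ 2 / T ^ 2 * ((m : ℝ) + T * z.1) ^ 2) :=
            div_le_div_of_nonneg_left (Real.rpow_nonneg hΛ0 _) hwpos (hDw.trans hD2)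
        _ = Λ ^ (5 / 2 : ℝ) * T ^ 2 / Λ ^ 2 * (1 / ((m : ℝ) + T * z.1) ^ 2) := by
            field_simp
    have hgsum : Summable g := by
      refine Summable.of_norm_bounded_eventually
        (((Real.summable_one_div_int_add_rpow (T * z.1) 2).2 (by norm_num)).mul_left (Λ ^ (5 / 2 : ℝ) * T ^ 2 / Λ ^ 2)) ?_
      filter_upwards [hev] with m hm
      rw [Real.norm_eq_abs, abs_of_nonneg (by rw [hg]; exact div_nonneg (Real.rpow_nonneg hΛ0 _) (sq_nonneg _))]
      exact hmaj m hm
    have hKg : Summable fun m : ℤ => K * g m := hgsum.mul_left K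
    have hnorm : Summable fun m : ℤ => ‖(-1 : ℂ) ^ m * zeroKernel (etaSymbol u Λ T θs) (z.1 + (m : ℝ) / T, z.2)‖ :=
      Summable.of_nonneg_of_le (fun m => norm_nonneg _) hterm hKg
    calc ‖∑' m : ℤ, (-1 : ℂ) ^ m * zeroKernel (etaSymbol u Λ T θs) (z.1 + (m : ℝ) / T, z.2)‖
        ≤ ∑' m : ℤ, ‖(-1 : ℂ) ^ m * zeroKernel (etaSymbol u Λ T θs) (z.1 + (m : ℝ) / T, z.2)‖ :=
          norm_tsum_le_tsum_norm hnorm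
      _ ≤ ∑' m : ℤ, K * g m := hnorm.tsum_le_tsum hterm hKg
      _ = K * ∑' m : ℤ, g m := tsum_mul_left

end Literature.MathematicalPhysics.QuantumLattice.FermiRG.DR2000

end
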